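import Summits.BirchSwinnertonDyer.BirchSwinnertonDyer.Theorems.SchneiderFreeAdditiveX3Defs
import Summits.BirchSwinnertonDyer.Rank1Residual.X11b.RouteR1IntReceptacle
import Summits.BirchSwinnertonDyer.Rank1Residual.X11b.AnticyclotomicSelmerDual
import Literature.NumberTheory.EllipticCurves.Rank1Residual.Predicates
import Literature.NumberTheory.EllipticCurves.HeegnerPoints
import Literature.NumberTheory.EllipticCurves.ModularCurve
import Literature.NumberTheory.EllipticCurves.IwasawaCharGeneratorMuLambda
import Literature.RingTheory.PowerSeries.ResidualOrderAssociated
import HarnessLib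

/-!
# Route `PrintCFram`, crux C2 `BottomClassIndexLawFiveLe` (stmt-BirchSwinnertonDyer-20372), line `eisenstein-resource-bdp-line`:
# the registered upgrade stub `stub_invariantUpgrade_cmRamified` REDUCED BY NAME to the Greenberg–Vatsal INVARIANT MATCH
# «`X_(∅,0)` is finitely generated torsion, `μ_an(Q) = μ(X)`, `λ_an(Q) = λ(X)`» (CGLS 2022 Thm. 3.2.1 shape), through the
# landed hinge (`Literature/RingTheory/PowerSeries/ResidualOrderAssociated.lean`) and bridge
# (`Literature/NumberTheory/EllipticCurves/IwasawaCharGeneratorMuLambda.lean`)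
# (cell `bsd-print-cfram`, seat `bsd-line-cfram-p1` LEAD g3; helper `--supports` 20372; THEOREMS ONLY, 0 facts)

HONEST FRAMING. Nothing about BSD is proved; the stub is NOT closed. This file sharpens the by-name socket of
`…EisensteinUpgradeOfInvariants.lean` (stub 2 ⟸ a principal generator + common `μ`-part + equal residual order) to
MODULE invariants: `stub_invariantUpgrade_cmRamified_of_moduleInvariants` proves the REGISTERED signature of
`stub_invariantUpgrade_cmRamified` verbatim from ONE displayed hypothesis `hinvM` = «at every CM-ramified row / Heegner field /
anticyclotomic frame / ♭-BDP frame `Q` where the Eisenstein inclusion holds: the anticyclotomic Selmer dual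
`X = XAc (W/K'') p κ 𝔭' ∅ γ` is a finitely generated torsion `Λ`-module, and `Q = C(p^{μ(X)}) · Q₀` with `ord Q̄₀ = λ(X)`»
— literally «`X` torsion, `μ(Q) = μ(X)`, `λ(Q) = λ(X)`», the conclusion of a Greenberg–Vatsal comparison
(Castella–Grossi–Lee–Skinner 2022 Thm. 3.2.1 + (an-inv)) transplanted to the additive split prime — UNPRINTED there; that is the
research left in stub 2. Ingredients (all in the tree, axioms standard): the char power series of a f.g. torsion `Λ`-module is
`p^{μ} g₀` with `ḡ₀ ≠ 0` of order `λ` (`exists_charIdeal_eq_span_C_pow_mu_mul`); residual order and non-vanishing are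
invariant under `ℤ_p → 𝓞_{ℂ_p}` (`order_map_residue_map_eq_of_mem_maximalIdeal_iff` with `toCpInt_mem_maximalIdeal_iff`
below); the `μ`-twisted hinge (`span_singleton_le_of_le_of_eq_mul_of_order_map_residue_eq`). BSD is not proved by any of this.

References: Castella–Grossi–Lee–Skinner, Invent. Math. 227 (2022) Thm. 3.2.1, proof of Thm. 5.1.1 (arXiv:2008.02571 pp. 4, 23)
[CastellaGrossiLeeSkinner2022]; Greenberg–Vatsal, Invent. Math. 142 (2000) §1 [GreenbergVatsal2000]; Washington GTM 83 §13.2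
[Washington1997].
-/

noncomputable section

open scoped Classical

set_option linter.dupNamespace false
set_option autoImplicit false

namespace Summit.BirchSwinnertonDyer.BirchSwinnertonDyer.Theorems.PrintCFram.EisensteinResourceBdpLine

open WeierstrassCurve NumberField IsDedekindDomain Field PowerSeries
  Literature.NumberTheory.EllipticCurves
  Literature.NumberTheory.EllipticCurves.ModularForms
  Literature.NumberTheory.EllipticCurves.Rank1Residual
  Literature.NumberTheory.GaloisRepresentations
  Summit.BirchSwinnertonDyer.Rank1Residual
  Summit.BirchSwinnertonDyer.Rank1Residual.X11b
  Summit.BirchSwinnertonDyer.Rank1Residual.X11b.AcSelmer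
  Summit.BirchSwinnertonDyer.BirchSwinnertonDyer.Theorems
  Summit.BirchSwinnertonDyer.BirchSwinnertonDyer.Theorems.SchneiderFree

/-! ## §1 The structure map `ℤ_p → 𝓞_{ℂ_p}` detects the maximal ideals -/

section ToCpInt

variable {p : ℕ} [Fact p.Prime]

/-- A unit of `𝓞_{ℂ_p}` has norm `1` in `ℂ_p`. [folklore] -/
private theorem norm_eq_one_of_isUnit {x : PadicComplexInt p} (hx : IsUnit x) : ‖(x : ℂ_[p])‖ = 1 := by
  obtain ⟨u, rfl⟩ := hx
  have h1 : ‖((u : PadicComplexInt p) : ℂ_[p])‖ * ‖(((u⁻¹ : (PadicComplexInt p)ˣ) : PadicComplexInt p) : ℂ_[p])‖ = 1 := by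
    rw [← norm_mul, ← MulMemClass.coe_mul, Units.mul_inv, OneMemClass.coe_one, norm_one]
  have ha := R1.norm_coe_padicComplexInt_le_one p (u : PadicComplexInt p)
  have hb := R1.norm_coe_padicComplexInt_le_one p ((u⁻¹ : (PadicComplexInt p)ˣ) : PadicComplexInt p)
  have h0 := norm_nonneg (((u : PadicComplexInt p)) : ℂ_[p])
  nlinarith

/-- `p` lies in the maximal ideal of `𝓞_{ℂ_p}` (`‖p‖ = p⁻¹ < 1`). [folklore] -/
theorem toCpInt_p_mem_maximalIdeal : R1.toCpInt p (p : ℤ_[p]) ∈ IsLocalRing.maximalIdeal (PadicComplexInt p) := by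
  rw [IsLocalRing.mem_maximalIdeal, mem_nonunits_iff]
  intro hu
  have h1 := norm_eq_one_of_isUnit hu
  rw [R1.coe_toCpInt, norm_algebraMap', PadicInt.padic_norm_e_of_padicInt, PadicInt.norm_p, inv_eq_one] at h1
  have hp : (1 : ℝ) < p := by exact_mod_cast (Fact.out : p.Prime).one_lt
  linarith

/-- **The structure map detects the maximal ideals: `toCpInt a ∈ 𝔪_{𝓞_{ℂ_p}} ↔ a ∈ 𝔪_{ℤ_p} = (p)`.** [folklore] -/
theorem toCpInt_mem_maximalIdeal_iff (a : ℤ_[p]) :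
    R1.toCpInt p a ∈ IsLocalRing.maximalIdeal (PadicComplexInt p) ↔ a ∈ IsLocalRing.maximalIdeal ℤ_[p] := by
  constructor
  · intro h
    by_contra ha
    rw [IsLocalRing.mem_maximalIdeal, mem_nonunits_iff, not_not] at ha
    exact (IsLocalRing.mem_maximalIdeal _).mp h |> mem_nonunits_iff.mp <| ha.map (R1.toCpInt p)
  · intro h
    rw [PadicInt.maximalIdeal_eq_span_p, Ideal.mem_span_singleton] at h
    obtain ⟨b, rfl⟩ := h
    rw [map_mul]
    exact Ideal.mul_mem_right _ _ toCpInt_p_mem_maximalIdeal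

end ToCpInt

/-! ## §2 Stub 2 ⟸ «X torsion, μ(Q) = μ(X), λ(Q) = λ(X)» -/

/-- **Stub 2 of the skeleton of record ⟸ the Greenberg–Vatsal invariant match, BY NAME.** The conclusion is the REGISTERED
signature of `stub_invariantUpgrade_cmRamified` verbatim; the hypothesis `hinvM` asks, at every frame where the Eisenstein
inclusion `Ch·𝓞_{ℂ_p}⟦T⟧ ⊆ (Q)` holds, that `X = XAc (W/K'') p κ 𝔭' ∅ γ` be a finitely generated torsion `Λ`-module and that
`Q = C(p^{μ(X)})·Q₀` with `ord Q̄₀ = λ(X)` (analytic `μ`, `λ` of `Q` = algebraic `μ`, `λ` of `X`). Proof: the bridge gives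
`char(X) = (C(p^{μ(X)}) g₀)` with `ḡ₀ ≠ 0`, `ord ḡ₀ = λ(X)`; map along `ℤ_p → 𝓞_{ℂ_p}` (`Ideal.map_span`, transport of the
residual order by `toCpInt_mem_maximalIdeal_iff`); apply the `μ`-twisted hinge with `c = C(p^{μ(X)})`. CONDITIONAL on `hinvM`
(research: the GV comparison at an additive split prime and the Λ-adic congruence); closes nothing.
[cite: CastellaGrossiLeeSkinner2022, Thm. 3.2.1 and proof of Thm. 5.1.1 (arXiv:2008.02571 pp. 4, 23)]
[cite: GreenbergVatsal2000, §1 p. 18, (1)–(2)] [cite: Washington1997, §13.2] -/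
theorem stub_invariantUpgrade_cmRamified_of_moduleInvariants
    (hinvM : ∀ (p : ℕ) [Fact p.Prime] (W : WeierstrassCurve ℚ) [W.IsElliptic] [W.IsGloballyMinimal],
      W.HasCM → CMRamified W p → 5 ≤ p → W.analyticRank = 1 →
      ∀ (N : ℕ) [NeZero N] (K : Type) [Field K] [NumberField K] (Dt : ModularParametrizationData W N),
      W.conductorNorm ℤ = N → IsImaginaryQuadratic K → SatisfiesHeegnerHypothesis N K →
      ∀ (κ : ZpExtension K p), κ.IsAnticyclotomic → ∀ (γ : Field.absoluteGaloisGroup K) [Fact (κ.IsTopGenerator γ)]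
        (𝔭 : HeightOneSpectrum (𝓞 K)), ((p : ℕ) : 𝓞 K) ∈ 𝔭.asIdeal → 𝔭.asIdeal.ramificationIdx (𝓞 ℚ) = 1 →
        𝔭.asIdeal.inertiaDeg (𝓞 ℚ) = 1 → ∀ (𝔭' : HeightOneSpectrum (𝓞 K)), ((p : ℕ) : 𝓞 K) ∈ 𝔭'.asIdeal → 𝔭' ≠ 𝔭 →
        ∀ (ι' : PadicAlgCl p ≃+* ℂ), SchneiderFree.BranchInducesPrime p ι' 𝔭 →
        ∀ (ΩK : ℂ) (Ωp : ℂ_[p]) (Q : PowerSeries (PadicComplexInt p)), ΩK ≠ 0 → Ωp ≠ 0 →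
          R1.IsBDPLFunctionInt p ι' 𝔭 κ γ Dt.f ΩK Ωp Q →
          (XAc.charIdeal (W.baseChange K) p κ 𝔭' ∅ γ).map (PowerSeries.map (R1.toCpInt p)) ≤ Ideal.span {Q} →
          (Module.Finite (IwasawaAlgebra p) (XAc (W.baseChange K) p κ 𝔭' ∅ γ) ∧
           Module.IsTorsion (IwasawaAlgebra p) (XAc (W.baseChange K) p κ 𝔭' ∅ γ) ∧
           ∃ Q₀ : PowerSeries (PadicComplexInt p),
             Q = PowerSeries.C (R1.toCpInt p ((p : ℤ_[p]) ^
                   muInvariant p (XAc (W.baseChange K) p κ 𝔭' ∅ γ))) * Q₀ ∧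
             (PowerSeries.map (IsLocalRing.residue (PadicComplexInt p)) Q₀).order =
               lambdaInvariant p (XAc (W.baseChange K) p κ 𝔭' ∅ γ))) :
    ∀ (p : ℕ) [Fact p.Prime] (W : WeierstrassCurve ℚ) [W.IsElliptic] [W.IsGloballyMinimal],
      W.HasCM → CMRamified W p → 5 ≤ p → W.analyticRank = 1 →
      ∀ (N : ℕ) [NeZero N] (K : Type) [Field K] [NumberField K] (Dt : ModularParametrizationData W N),
      W.conductorNorm ℤ = N → IsImaginaryQuadratic K → SatisfiesHeegnerHypothesis N K →
      ∀ (κ : ZpExtension K p), κ.IsAnticyclotomic → ∀ (γ : Field.absoluteGaloisGroup K) [Fact (κ.IsTopGenerator γ)]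
        (𝔭 : HeightOneSpectrum (𝓞 K)), ((p : ℕ) : 𝓞 K) ∈ 𝔭.asIdeal → 𝔭.asIdeal.ramificationIdx (𝓞 ℚ) = 1 →
        𝔭.asIdeal.inertiaDeg (𝓞 ℚ) = 1 → ∀ (𝔭' : HeightOneSpectrum (𝓞 K)), ((p : ℕ) : 𝓞 K) ∈ 𝔭'.asIdeal → 𝔭' ≠ 𝔭 →
        ∀ (ι' : PadicAlgCl p ≃+* ℂ), SchneiderFree.BranchInducesPrime p ι' 𝔭 →
        ∀ (ΩK : ℂ) (Ωp : ℂ_[p]) (Q : PowerSeries (PadicComplexInt p)), ΩK ≠ 0 → Ωp ≠ 0 →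
          R1.IsBDPLFunctionInt p ι' 𝔭 κ γ Dt.f ΩK Ωp Q →
          (XAc.charIdeal (W.baseChange K) p κ 𝔭' ∅ γ).map (PowerSeries.map (R1.toCpInt p)) ≤ Ideal.span {Q} →
          Ideal.span {Q} ≤ (XAc.charIdeal (W.baseChange K) p κ 𝔭' ∅ γ).map (PowerSeries.map (R1.toCpInt p)) := by
  intro p _ W _ _ hCM hram h5 hr N _ K _ _ Dt hN hK hHN κ hκ γ _ 𝔭 h𝔭 he hf 𝔭' h𝔭' hne ι' hind ΩK Ωp Q hΩK hΩp hBDP hle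
  obtain ⟨hfin, htors, Q₀, hQ, hordQ⟩ :=
    hinvM p W hCM hram h5 hr N K Dt hN hK hHN κ hκ γ 𝔭 h𝔭 he hf 𝔭' h𝔭' hne ι' hind ΩK Ωp Q hΩK hΩp hBDP hle
  haveI := hfin
  -- the bridge: char(X) = (C(p^μ) · g₀), ḡ₀ ≠ 0, ord ḡ₀ = λ(X)
  obtain ⟨g₀, hchar, hg₀, hordg⟩ :=
    Literature.NumberTheory.EllipticCurves.exists_charIdeal_eq_span_C_pow_mu_mul
      (p := p) (XAc (W.baseChange K) p κ 𝔭' ∅ γ) htors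
  -- transport along ℤ_p → 𝓞_{ℂ_p}
  set J : ℤ_[p] →+* PadicComplexInt p := R1.toCpInt p with hJ
  set c : PowerSeries (PadicComplexInt p) :=
    PowerSeries.C (J ((p : ℤ_[p]) ^ muInvariant p (XAc (W.baseChange K) p κ 𝔭' ∅ γ))) with hc
  have hI : (XAc.charIdeal (W.baseChange K) p κ 𝔭' ∅ γ).map (PowerSeries.map J) =
      Ideal.span {c * PowerSeries.map J g₀} := by
    rw [XAc.charIdeal, hchar, Ideal.map_span, Set.image_singleton, map_mul, PowerSeries.map_C]
  have hc0 : c ≠ 0 := by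
    rw [hc]
    intro h0
    have h1 : J ((p : ℤ_[p]) ^ muInvariant p (XAc (W.baseChange K) p κ 𝔭' ∅ γ)) = 0 := by
      simpa using congrArg PowerSeries.constantCoeff h0
    rw [map_pow] at h1
    exact pow_ne_zero _ (fun hp0 => by
      have := congrArg (fun x : PadicComplexInt p => (x : ℂ_[p])) hp0
      simp [hJ] at this
      exact (Fact.out : p.Prime).ne_zero (by exact_mod_cast this)) h1
  have hg₀' : PowerSeries.map (IsLocalRing.residue (PadicComplexInt p)) (PowerSeries.map J g₀) ≠ 0 :=
    (Literature.RingTheory.PowerSeries.map_residue_map_ne_zero_iff_of_mem_maximalIdeal_iff J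
      toCpInt_mem_maximalIdeal_iff g₀).mpr hg₀
  have hordg' : (PowerSeries.map (IsLocalRing.residue (PadicComplexInt p)) Q₀).order =
      (PowerSeries.map (IsLocalRing.residue (PadicComplexInt p)) (PowerSeries.map J g₀)).order := by
    rw [Literature.RingTheory.PowerSeries.order_map_residue_map_eq_of_mem_maximalIdeal_iff J
      toCpInt_mem_maximalIdeal_iff g₀, hordg, hordQ]
  exact Literature.RingTheory.PowerSeries.span_singleton_le_of_le_of_eq_mul_of_order_map_residue_eq
    hI hle hc0 rfl hQ hg₀' hordg'

end Summit.BirchSwinnertonDyer.BirchSwinnertonDyer.Theorems.PrintCFram.EisensteinResourceBdpLine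

end
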